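import Literature.NumberTheory.GelbartRogawski1991.LocalUnitarySplittingDatum
import HarnessLib

/-!
# Unitary quasi-reflections of `U(J)(F_v)`, their symplectic action on `𝕎_v = Res(E_vᴺ)`, and the norm form of `E_v/F_v`

Topic `NumberTheory/Automorphic`; namespace `Literature.NumberTheory.Automorphic.UnitaryGroup`.  KERNEL ONLY: theorems; no
definition, no named fact, no record, no `sorry`.

Setting of `UnitaryGroupSymplecticCarriers.lean` / `GelbartRogawski1991/LocalUnitarySplittingDatum.lean`: `E/F` quadratic
number fields, `c ∈ Aut(E/F)`, `δ` with `c δ = -δ ≠ 0`, `δ² = d`, an `F`-rational symmetric Gram matrix `T`, `J = T ⊗ 1`, a finite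
place `v`, `E_v = E ⊗_F F_v` (`UnitaryGroup.LocalRing E v`, coordinates `z = φ(re z) + φ(im z) δ`, `φ = toLocalRing E v`,
`isQuadraticCoordinates_local`), the conjugation `σ = c ⊗ 1` (`conjLocal`), the local unitary group
`U(J)(F_v) = UnitaryGroup.«local» E c N J v ≤ GL_N(E_v)` and its factor form `localPi`, and the embedding
`ι_v : U(J)(F_v) → Sp(𝕎_v)` (`GelbartRogawski1991 … LocalSplitting.iota`) in the coordinates `reIm : E_vᴺ ≃ F_vᴺ × F_vᴺ`.

* §1 **quasi-reflections** ([Dieudonne1971GroupesClassiques, Chap. II §4]: the «quasi-symétries» and «transvections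
  unitaires» `x ↦ x + a h(u, x) u` of a hermitian form `h`, which are isometries exactly when `a + σ(a) + a σ(a) h(u, u) = 0`),
  over any commutative ring with an endomorphism `σ`: the matrix `1 + a · u ⊗ (uᵀ J)` for a `σ`-fixed vector `u` and a
  `σ`-fixed symmetric `J` satisfies `(σ g)ᵀ J g = J` under that relation (`transpose_map_reflMatrix_mul`), the composition law
  `(1 + a P)(1 + b P) = 1 + (a + b + a b h(u,u)) P` (`reflMatrix_mul_reflMatrix`) and the action `x ↦ x + a h(u,x) u`
  (`reflMatrix_mulVec`);
* §2 at the place `v`: the local form matrix `J_v = (T ⊗ 1) ⊗ 1` is `σ`-fixed and symmetric, the quasi-reflections of `F`-RATIONAL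
  vectors `u ∈ Fᴺ` lie in `U(J)(F_v)` (`reflMatrix_mem_local`), the symplectic action of any `g ∈ U(J)(F_v)` through `ι_v` is
  `reIm x ↦ reIm (g x)` (`iota_localPiEquiv_symm_reIm`, [MoeglinVignerasWaldspurger1987, Ch. 1 I.17]) and the commutator form
  of `𝕎_v` is the imaginary part of the hermitian form (`alt_polar_localPairing_reIm`);
* §3 the NORM FORM of `E_v/F_v` in coordinates: `σ(z) z = φ((re z)² - d (im z)²)` (`conjLocal_mul_self`), with the scalar rules of
  the hermitian form (`hermForm_smul_left`) — the quadratic form «`E` munie de la norme» of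
  [MoeglinVignerasWaldspurger1987, Chap. 1 I.11 (4 b)], anisotropic exactly when `E_v` is a field (used in
  `UnitaryGroupLocalExpansionNonsplit.lean`).

Written for the admissibility of the rank-one theta lift at a non-split place (fan B of the Hodge/COR-CM cell:
`RepresentationTheory/MoeglinVignerasWaldspurger1987/RankOneThetaLiftAdmissibleProofs.lean`).  Nothing of the cited sources is
asserted; everything is proved from Mathlib and the tree.

## References
* [Dieudonne1971GroupesClassiques] J. Dieudonné, *La géométrie des groupes classiques*, 3e éd., Springer (1971), Chap. II §4–§5.
* [MoeglinVignerasWaldspurger1987] C. Mœglin, M.-F. Vignéras, J.-L. Waldspurger, LNM 1291 (1987), Chap. 1 I.6, I.11, I.17.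
-/

set_option autoImplicit false

noncomputable section

open Matrix NumberField IsDedekindDomain
open Literature.RepresentationTheory.HeisenbergGroup
open Literature.NumberTheory.GelbartRogawski1991.UnitaryDualPair.LocalSplitting (iota iota_def localPairing)

namespace Literature.NumberTheory.Automorphic.UnitaryGroup

/-! ## §1 Quasi-reflections of a hermitian form over a commutative ring with involution -/

section Generic

variable {R : Type*} [CommRing R] {n : Type*} [Fintype n]

/-- **composition of quasi-reflections along one vector**: `(1 + a · u ⊗ r)(1 + b · u ⊗ r) = 1 + (a + b + a b ⟨r, u⟩) · u ⊗ r`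
(`r = uᵀ J`, `⟨r, u⟩ = h(u, u)`). [cite: Dieudonne1971GroupesClassiques, Chap. II §4] -/
theorem reflMatrix_mul_reflMatrix [DecidableEq n] (u r : n → R) (a b : R) :
    (1 + a • vecMulVec u r) * (1 + b • vecMulVec u r) = 1 + (a + b + a * b * (r ⬝ᵥ u)) • vecMulVec u r := by
  rw [add_mul, one_mul, mul_add, mul_one, Matrix.smul_mul, Matrix.mul_smul, vecMulVec_mul_vecMulVec, vecMulVec_smul,
    smul_smul, smul_smul]
  module

/-- **the action of a quasi-reflection**: `(1 + a · u ⊗ r) x = x + (a ⟨r, x⟩) · u`. [cite: Dieudonne1971GroupesClassiques, Chap. II §4] -/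
theorem reflMatrix_mulVec [DecidableEq n] (u r : n → R) (a : R) (x : n → R) :
    (1 + a • vecMulVec u r) *ᵥ x = x + (a * (r ⬝ᵥ x)) • u := by
  rw [add_mulVec, one_mulVec, smul_mulVec, vecMulVec_mulVec]
  ext i
  simp only [Pi.add_apply, Pi.smul_apply, MulOpposite.smul_eq_mul_unop, MulOpposite.unop_op, smul_eq_mul]
  ring

/-- the row `r = uᵀ J` of a `σ`-fixed vector against a `σ`-fixed matrix is `σ`-fixed. [folklore] -/
private theorem conj_vecMul_apply (σ : R →+* R) {u : n → R} (hu : ∀ i, σ (u i) = u i) {J : Matrix n n R}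
    (hJσ : J.map σ = J) (j : n) : σ ((u ᵥ* J) j) = (u ᵥ* J) j := by
  simp only [vecMul, dotProduct, map_sum, map_mul, hu]
  refine Finset.sum_congr rfl fun i _ => ?_
  have := congrFun (congrFun hJσ i) j
  rw [Matrix.map_apply] at this
  rw [this]

/-- **a quasi-reflection is an isometry**: for `u` and `J = Jᵀ` fixed by `σ` and `a + σ(a) + a σ(a) h(u,u) = 0`,
`(σ g)ᵀ J g = J` for `g = 1 + a · u ⊗ (uᵀ J)`. [cite: Dieudonne1971GroupesClassiques, Chap. II §4] -/
theorem transpose_map_reflMatrix_mul [DecidableEq n] (σ : R →+* R) {u : n → R} (hu : ∀ i, σ (u i) = u i)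
    {J : Matrix n n R} (hJσ : J.map σ = J) (hJt : Jᵀ = J) {a : R} (ha : a + σ a + a * σ a * ((u ᵥ* J) ⬝ᵥ u) = 0) :
    ((1 + a • vecMulVec u (u ᵥ* J)).map σ)ᵀ * J * (1 + a • vecMulVec u (u ᵥ* J)) = J := by
  have hmap : (1 + a • vecMulVec u (u ᵥ* J)).map σ = 1 + σ a • vecMulVec u (u ᵥ* J) := by
    ext i j
    simp only [Matrix.map_apply, Matrix.add_apply, Matrix.one_apply, Matrix.smul_apply, vecMulVec_apply, smul_eq_mul,
      map_add, map_mul, hu, conj_vecMul_apply σ hu hJσ j]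
    split_ifs <;> simp
  have hJu : J *ᵥ u = u ᵥ* J := by rw [← mulVec_transpose, hJt]
  rw [hmap, transpose_add, transpose_one, transpose_smul, transpose_vecMulVec, add_mul, one_mul, Matrix.smul_mul,
    vecMulVec_mul, mul_add, mul_one, add_mul, Matrix.mul_smul, mul_vecMulVec, hJu, Matrix.mul_smul, Matrix.smul_mul,
    vecMulVec_mul_vecMulVec, vecMulVec_smul, smul_smul]
  have h0 : σ a + (a + a * σ a * (u ᵥ* J ⬝ᵥ u)) = 0 := by rw [← ha]; ring
  rw [smul_smul, ← add_smul, add_assoc, ← add_smul, h0, zero_smul, add_zero]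

/-- the scalar rule of the hermitian pairing `h(x, y) = (σ x)ᵀ H y` in the first variable: `h(λ y, x) = σ(λ) h(y, x)`.
[cite: MoeglinVignerasWaldspurger1987, Ch. 1 I.17] -/
theorem hermForm_smul_left (σ : R →+* R) (J : Matrix n n R) (t : R) (y x : n → R) :
    hermForm σ J (t • y) x = σ t * hermForm σ J y x := by
  rw [hermForm_apply, hermForm_apply]
  have : (⇑σ ∘ (t • y)) = σ t • (⇑σ ∘ y) := by
    funext i
    simp [map_mul]
  rw [this, smul_dotProduct, smul_eq_mul]

/-- the hermitian pairing against a `σ`-fixed vector is the bilinear one: `h(u, x) = ⟨uᵀ J, x⟩`.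
[cite: MoeglinVignerasWaldspurger1987, Ch. 1 I.17] -/
theorem hermForm_eq_vecMul_dotProduct (σ : R →+* R) (J : Matrix n n R) {u : n → R} (hu : ∀ i, σ (u i) = u i)
    (x : n → R) : hermForm σ J u x = (u ᵥ* J) ⬝ᵥ x := by
  rw [hermForm_apply, ← dotProduct_mulVec]
  congr 1
  funext i
  exact hu i

end Generic

/-! ## §2 At a finite place: the local form matrix, membership of quasi-reflections, the action through `ι_v` -/

section Local

variable {F : Type} [Field F] [NumberField F] (E : Type) [Field E] [NumberField E] [Algebra F E]
  [Algebra.IsQuadraticExtension F E] (c : E ≃ₐ[F] E) {N : ℕ}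
  {δ : E} (hcδ : c δ = -δ) (hδ : δ ≠ 0) {d : F} (hd : δ * δ = algebraMap F E d)
  (T : Matrix (Fin N) (Fin N) F) (hT : T.IsSymm)
  {J : Matrix (Fin N) (Fin N) E} (hJ : J = T.map (algebraMap F E))
  (v : HeightOneSpectrum (𝓞 F))

omit [Algebra.IsQuadraticExtension F E] in
/-- the local form matrix `J_v = (T ⊗ 1) ⊗ 1 ∈ M_N(E_v)` is fixed entrywise by `σ = c ⊗ 1`. [folklore] -/
private theorem localFormMatrix_map_conjLocal :
    ((T.map (algebraMap F (v.adicCompletion F))).map (toLocalRing E v)).map (conjLocal E c v) =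
      (T.map (algebraMap F (v.adicCompletion F))).map (toLocalRing E v) := by
  ext i j
  simp only [Matrix.map_apply, conjLocal_toLocalRing]

omit [Algebra.IsQuadraticExtension F E] in
include hT in
/-- the local form matrix is symmetric (`T` is). [folklore] -/
private theorem localFormMatrix_transpose :
    ((T.map (algebraMap F (v.adicCompletion F))).map (toLocalRing E v))ᵀ =
      (T.map (algebraMap F (v.adicCompletion F))).map (toLocalRing E v) := by
  rw [← transpose_map, ← transpose_map, hT.eq]

omit [Algebra.IsQuadraticExtension F E] in
/-- an `F`-rational vector is fixed by `σ = c ⊗ 1`. [folklore] -/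
private theorem conjLocal_ratVec (u : Fin N → F) (i : Fin N) :
    conjLocal E c v (toLocalRing E v ((u i : F) : v.adicCompletion F)) = toLocalRing E v ((u i : F) : v.adicCompletion F) :=
  conjLocal_toLocalRing c v _

omit [Algebra.IsQuadraticExtension F E] in
include hT hJ in
/-- **quasi-reflections of rational vectors lie in `U(J)(F_v)`**: for `u ∈ Fᴺ`, `J_v = (T ⊗ 1) ⊗ 1` and `a ∈ E_v` with
`a + σ(a) + a σ(a) h(u, u) = 0`, the pair `(1 + a · u ⊗ uᵀJ_v, 1 + σ(a) · u ⊗ uᵀJ_v)` is a unit of `M_N(E_v)` lying in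
`UnitaryGroup.«local» E c N J v`. [cite: Dieudonne1971GroupesClassiques, Chap. II §4] -/
theorem reflMatrix_mem_local (u : Fin N → F) {a : UnitaryGroup.LocalRing E v}
    (ha : a + conjLocal E c v a + a * conjLocal E c v a *
      (((fun i => toLocalRing E v ((u i : F) : v.adicCompletion F)) ᵥ*
          (T.map (algebraMap F (v.adicCompletion F))).map (toLocalRing E v)) ⬝ᵥ
        fun i => toLocalRing E v ((u i : F) : v.adicCompletion F)) = 0) :
    ∃ g : UnitaryGroup.«local» E c N J v,
      (g : GL (Fin N) (LocalRing E v)).val =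
        1 + a • vecMulVec (fun i => toLocalRing E v ((u i : F) : v.adicCompletion F))
          ((fun i => toLocalRing E v ((u i : F) : v.adicCompletion F)) ᵥ*
            (T.map (algebraMap F (v.adicCompletion F))).map (toLocalRing E v)) := by
  set uv : Fin N → UnitaryGroup.LocalRing E v := fun i => toLocalRing E v ((u i : F) : v.adicCompletion F) with huv
  set Jv := (T.map (algebraMap F (v.adicCompletion F))).map (toLocalRing E v) with hJv
  set cu := (uv ᵥ* Jv) ⬝ᵥ uv with hcu
  have ha' : conjLocal E c v a + a + conjLocal E c v a * a * cu = 0 := by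
    rw [← ha]; ring
  have h1 : (1 + a • vecMulVec uv (uv ᵥ* Jv)) * (1 + conjLocal E c v a • vecMulVec uv (uv ᵥ* Jv)) = 1 := by
    rw [reflMatrix_mul_reflMatrix, ha, zero_smul, add_zero]
  have h2 : (1 + conjLocal E c v a • vecMulVec uv (uv ᵥ* Jv)) * (1 + a • vecMulVec uv (uv ᵥ* Jv)) = 1 := by
    rw [reflMatrix_mul_reflMatrix, ha', zero_smul, add_zero]
  let g₀ : GL (Fin N) (UnitaryGroup.LocalRing E v) := ⟨_, _, h1, h2⟩
  have hmem : g₀ ∈ UnitaryGroup.«local» E c N J v := by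
    rw [UnitaryGroup.«local», localForm_eq_map E N v T hJ, mem_unitaryGroupOfForm_iff]
    exact transpose_map_reflMatrix_mul (conjLocal E c v) (fun i => conjLocal_ratVec E c v u i)
      (localFormMatrix_map_conjLocal E c T v) (localFormMatrix_transpose E T hT v) ha
  exact ⟨⟨g₀, hmem⟩, rfl⟩

/-- **the symplectic action of `U(J)(F_v)` through `ι_v` is the linear action on `E_vᴺ` in the coordinates `reIm`**:
`ι_v(g) (reIm x) = reIm (g x)` for `g ∈ U(J)(F_v)` (read on the factor form `localPi` through `localPiEquiv`).
[cite: MoeglinVignerasWaldspurger1987, Ch. 1 I.17] -/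
theorem iota_localPiEquiv_symm_reIm (g : UnitaryGroup.«local» E c N J v) (x : Fin N → UnitaryGroup.LocalRing E v) :
    (iota F E c N hcδ hδ hd T hT hJ v ((localPiEquiv E c N J v).symm g)).1
        (QuadraticCoordinates.reIm (quadraticLocalEquiv E v c hcδ hδ).toLinearEquiv.toAddEquiv (Fin N) x) =
      QuadraticCoordinates.reIm (quadraticLocalEquiv E v c hcδ hδ).toLinearEquiv.toAddEquiv (Fin N)
        ((g : GL (Fin N) (LocalRing E v)).val *ᵥ x) := by
  rw [iota_def]
  show ((localToSymplectic E c N v hcδ hδ hd hT hJ) ((localPiEquiv E c N J v) ((localPiEquiv E c N J v).symm g))).1 _ = _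
  rw [ContinuousMulEquiv.apply_symm_apply]
  exact localToSymplectic_reIm E c N v hcδ hδ hd hT hJ g x

include hd hT in
/-- **the commutator form of `𝕎_v` is the imaginary part of the hermitian form**:
`A(reIm y, reIm x) = im h(y, x)` for `A = alt (polar β_{𝕋_v})`, `h(y, x) = (σ y)ᵀ J_v x`. [cite: MoeglinVignerasWaldspurger1987, Ch. 1 I.17] -/
theorem alt_polar_localPairing_reIm (y x : Fin N → UnitaryGroup.LocalRing E v) :
    alt (polar (localPairing F N T v))
        (QuadraticCoordinates.reIm (quadraticLocalEquiv E v c hcδ hδ).toLinearEquiv.toAddEquiv (Fin N) y)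
        (QuadraticCoordinates.reIm (quadraticLocalEquiv E v c hcδ hδ).toLinearEquiv.toAddEquiv (Fin N) x) =
      QuadraticCoordinates.im (quadraticLocalEquiv E v c hcδ hδ).toLinearEquiv.toAddEquiv
        (hermForm (conjLocal E c v) ((T.map (algebraMap F (v.adicCompletion F))).map (toLocalRing E v)) y x) :=
  ((isQuadraticCoordinates_local E v c hcδ hδ hd).im_hermForm_map (Fin N) (Matrix.IsSymm.map hT _) (conjLocal_toLocalRing c v)
    (by rw [conjLocal_algebraMap, hcδ, map_neg]) y x).symm

/-! ## §3 The norm form of `E_v/F_v` in coordinates -/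

include hcδ in
omit [Algebra.IsQuadraticExtension F E] in
/-- `σ = c ⊗ 1` negates `δ ⊗ 1` in `E ⊗_F F_v`. [cite: CasselsFrohlichANT1967, Ch. II §10] -/
theorem conjLocal_delta : conjLocal E c v (algebraMap E (UnitaryGroup.LocalRing E v) δ) =
    -algebraMap E (UnitaryGroup.LocalRing E v) δ := by
  rw [conjLocal_algebraMap, hcδ, map_neg]

include hd in
/-- `σ` in coordinates: `σ z = φ(re z) + φ(-im z) δ`. [folklore] -/
private theorem conjLocal_eq_coords (z : UnitaryGroup.LocalRing E v) :
    conjLocal E c v z = toLocalRing E v (QuadraticCoordinates.re (quadraticLocalEquiv E v c hcδ hδ).toLinearEquiv.toAddEquiv z) +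
      toLocalRing E v (-QuadraticCoordinates.im (quadraticLocalEquiv E v c hcδ hδ).toLinearEquiv.toAddEquiv z) *
        algebraMap E (UnitaryGroup.LocalRing E v) δ := by
  have hq := isQuadraticCoordinates_local E v c hcδ hδ hd
  conv_lhs => rw [← hq.re_add_im z]
  rw [map_add, map_mul, conjLocal_toLocalRing, conjLocal_toLocalRing, conjLocal_delta E c hcδ v, map_neg]
  ring

include hd in
/-- **the norm form**: `σ(z) z = φ((re z)² - d (im z)²)` in `E_v = F_v ⊕ F_v δ`, `δ² = d` — the quadratic form «`E` munie de la
norme» of the classification of anisotropic spaces. [cite: MoeglinVignerasWaldspurger1987, Chap. 1 I.11 (4 b)] -/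
theorem conjLocal_mul_self (z : UnitaryGroup.LocalRing E v) :
    conjLocal E c v z * z = toLocalRing E v
      (QuadraticCoordinates.re (quadraticLocalEquiv E v c hcδ hδ).toLinearEquiv.toAddEquiv z ^ 2 -
        (d : v.adicCompletion F) *
          QuadraticCoordinates.im (quadraticLocalEquiv E v c hcδ hδ).toLinearEquiv.toAddEquiv z ^ 2) := by
  have hq := isQuadraticCoordinates_local E v c hcδ hδ hd
  set α := QuadraticCoordinates.re (quadraticLocalEquiv E v c hcδ hδ).toLinearEquiv.toAddEquiv z with hα
  set β := QuadraticCoordinates.im (quadraticLocalEquiv E v c hcδ hδ).toLinearEquiv.toAddEquiv z with hβ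
  have hz : toLocalRing E v α + toLocalRing E v β * algebraMap E (UnitaryGroup.LocalRing E v) δ = z := hq.re_add_im z
  rw [conjLocal_eq_coords E c hcδ hδ hd v z, ← hα, ← hβ]
  conv_lhs => rw [← hz]
  rw [hq.mul_formula]
  have him : α * β + -β * α = 0 := by ring
  rw [him, map_zero, zero_mul, add_zero]
  congr 1
  ring

include hd in
/-- `im (σ z) = - im z` in `E ⊗_F F_v = F_v ⊕ F_v δ`. [cite: CasselsFrohlichANT1967, Ch. II §10] -/
theorem im_conjLocal (z : UnitaryGroup.LocalRing E v) :
    QuadraticCoordinates.im (quadraticLocalEquiv E v c hcδ hδ).toLinearEquiv.toAddEquiv (conjLocal E c v z) =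
      -QuadraticCoordinates.im (quadraticLocalEquiv E v c hcδ hδ).toLinearEquiv.toAddEquiv z :=
  (isQuadraticCoordinates_local E v c hcδ hδ hd).im_conj (conjLocal_toLocalRing c v) (conjLocal_delta E c hcδ v) z

include hd in
/-- `re (σ z) = re z` in `E ⊗_F F_v = F_v ⊕ F_v δ`. [cite: CasselsFrohlichANT1967, Ch. II §10] -/
theorem re_conjLocal (z : UnitaryGroup.LocalRing E v) :
    QuadraticCoordinates.re (quadraticLocalEquiv E v c hcδ hδ).toLinearEquiv.toAddEquiv (conjLocal E c v z) =
      QuadraticCoordinates.re (quadraticLocalEquiv E v c hcδ hδ).toLinearEquiv.toAddEquiv z :=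
  (isQuadraticCoordinates_local E v c hcδ hδ hd).re_conj (conjLocal_toLocalRing c v) (conjLocal_delta E c hcδ v) z

include hd in
/-- the trace of `E ⊗_F F_v / F_v` in coordinates: `z + σ z = φ(2 re z)`. [cite: CasselsFrohlichANT1967, Ch. II §10] -/
theorem add_conjLocal (z : UnitaryGroup.LocalRing E v) :
    z + conjLocal E c v z =
      toLocalRing E v (2 * QuadraticCoordinates.re (quadraticLocalEquiv E v c hcδ hδ).toLinearEquiv.toAddEquiv z) :=
  (isQuadraticCoordinates_local E v c hcδ hδ hd).add_conj (conjLocal_toLocalRing c v) (conjLocal_delta E c hcδ v) z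

end Local

/-! ## §4 An `F`-rational orthogonal basis for `T` and the reconstruction of `x ∈ E_vᴺ` from the pairings `h(b_i, x)` -/

section Basis

variable {F : Type} [Field F] [CharZero F] {N : ℕ} (T : Matrix (Fin N) (Fin N) F)

/-- **orthogonal bases** («tout espace ε-hermitien non alterné admet une base orthogonale», Schmidt's procedure): a symmetric
`T ∈ GL_N(F)` admits `F`-rational vectors `b₁, …, b_N` with `bᵢᵀ T bᵢ = cᵢ ≠ 0`, `bᵢᵀ T bⱼ = 0` (`i ≠ j`), forming a basis — recorded
as the existence of a matrix `Q` with `Q · (B T) = 1`, `B` the matrix of rows `bᵢ`. [cite: MoeglinVignerasWaldspurger1987, Chap. 1 I.6] -/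
theorem exists_orthogonal_rows (hT : T.IsSymm) (hTd : IsUnit T.det) :
    ∃ (b : Fin N → Fin N → F) (cb : Fin N → F) (Q : Matrix (Fin N) (Fin N) F),
      (∀ i, cb i ≠ 0) ∧ (∀ i, (b i ᵥ* T) ⬝ᵥ b i = cb i) ∧ (∀ i j, i ≠ j → (b i ᵥ* T) ⬝ᵥ b j = 0) ∧
        Q * (Matrix.of b * T) = 1 := by
  classical
  haveI : Invertible (2 : F) := invertibleOfNonzero two_ne_zero
  have hsym : LinearMap.IsSymm (Matrix.toBilin' T) := LinearMap.isSymm_def.2 fun x y => by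
    rw [RingHom.id_apply, Matrix.toBilin'_apply', Matrix.toBilin'_apply', dotProduct_mulVec, dotProduct_comm,
      ← Matrix.mulVec_transpose, hT.eq]
  obtain ⟨w, hw⟩ := LinearMap.BilinForm.exists_orthogonal_basis (V := Fin N → F) (B := Matrix.toBilin' T) hsym
  set e : Fin (Module.finrank F (Fin N → F)) ≃ Fin N := finCongr (Module.finrank_fin_fun F) with he
  set b : Module.Basis (Fin N) F (Fin N → F) := w.reindex e with hb
  have hbo : (Matrix.toBilin' T).IsOrthoᵢ b := by
    intro i j hij
    have := hw (e.symm.injective.ne hij)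
    simpa only [Function.onFun, hb, Module.Basis.reindex_apply] using this
  have hsep : (Matrix.toBilin' T).SeparatingLeft :=
    (Matrix.Nondegenerate.toBilin' (Matrix.nondegenerate_of_det_ne_zero hTd.ne_zero)).1
  have hpair : ∀ x y : Fin N → F, Matrix.toBilin' T x y = (x ᵥ* T) ⬝ᵥ y := fun x y => by
    rw [Matrix.toBilin'_apply', dotProduct_mulVec]
  -- the matrix of rows `bᵢ` is invertible: `(Pi.basisFun).toMatrix b = (of b)ᵀ`
  have hX : ((Pi.basisFun F (Fin N)).toMatrix b)ᵀ = Matrix.of (fun i => (b i : Fin N → F)) := by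
    ext i j
    rfl
  have hinv : (b.toMatrix (Pi.basisFun F (Fin N)))ᵀ * Matrix.of (fun i => (b i : Fin N → F)) = 1 := by
    rw [← hX, ← transpose_mul, Module.Basis.toMatrix_mul_toMatrix_flip, transpose_one]
  refine ⟨fun i => b i, fun i => (b i ᵥ* T) ⬝ᵥ b i, T⁻¹ * (b.toMatrix (Pi.basisFun F (Fin N)))ᵀ,
    fun i => ?_, fun i => rfl, fun i j hij => ?_, ?_⟩
  · show (b i ᵥ* T) ⬝ᵥ b i ≠ 0
    rw [← hpair]
    exact hbo.not_isOrtho_basis_self_of_separatingLeft hsep i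
  · show (b i ᵥ* T) ⬝ᵥ b j = 0
    rw [← hpair]
    exact hbo hij
  · rw [Matrix.mul_assoc, ← Matrix.mul_assoc _ (Matrix.of _) T, hinv, Matrix.one_mul, Matrix.nonsing_inv_mul T hTd]

end Basis

section Reconstruct

variable {F : Type} [Field F] [NumberField F] (E : Type) [Field E] [NumberField E] [Algebra F E] {N : ℕ}
  (T : Matrix (Fin N) (Fin N) F) (v : HeightOneSpectrum (𝓞 F))

/-- **reconstruction of `x ∈ E_vᴺ` from its pairings with a rational basis**: if `Q · (B T) = 1` over `F` (`B` = rows `bᵢ`), then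
`x_j = Σᵢ Q_{ji} · ⟨bᵢᵀ J_v, x⟩` for every `x ∈ E_vᴺ`, `J_v = (T ⊗ 1) ⊗ 1`. [cite: WeilBNT1967, Chap. II §1 Prop. 3] -/
theorem apply_eq_sum_mul_vecMul_dotProduct {b : Fin N → Fin N → F} {Q : Matrix (Fin N) (Fin N) F}
    (hQ : Q * (Matrix.of b * T) = 1) (x : Fin N → UnitaryGroup.LocalRing E v) (j : Fin N) :
    x j = ∑ i, toLocalRing E v ((Q j i : F) : v.adicCompletion F) *
      (((fun k => toLocalRing E v ((b i k : F) : v.adicCompletion F)) ᵥ*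
          (T.map (algebraMap F (v.adicCompletion F))).map (toLocalRing E v)) ⬝ᵥ x) := by
  set φ : F →+* UnitaryGroup.LocalRing E v := (toLocalRing E v).comp (algebraMap F (v.adicCompletion F)) with hφ
  have hφa : ∀ t : F, toLocalRing E v ((t : F) : v.adicCompletion F) = φ t := fun t => rfl
  have hJ : (T.map (algebraMap F (v.adicCompletion F))).map (toLocalRing E v) = T.map φ := by
    rw [Matrix.map_map]; rfl
  have hQ' : Q.map φ * ((Matrix.of b).map φ * T.map φ) = 1 := by
    rw [← Matrix.map_mul, ← Matrix.map_mul, hQ, Matrix.map_one φ (map_zero φ) (map_one φ)]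
  have hrow : ∀ i, (((Matrix.of b).map φ * T.map φ) *ᵥ x) i = ((fun k => φ (b i k)) ᵥ* T.map φ) ⬝ᵥ x := by
    intro i
    rw [← mulVec_mulVec]
    simp only [mulVec, dotProduct, vecMul, Matrix.map_apply, Matrix.of_apply, Finset.mul_sum, Finset.sum_mul, mul_assoc]
    exact Finset.sum_comm
  have hu : ∀ i, (fun k => toLocalRing E v ((b i k : F) : v.adicCompletion F)) = fun k => φ (b i k) :=
    fun i => funext fun k => hφa (b i k)
  calc x j = ((Q.map φ * ((Matrix.of b).map φ * T.map φ)) *ᵥ x) j := by rw [hQ', one_mulVec]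
    _ = ∑ i, φ (Q j i) * (((Matrix.of b).map φ * T.map φ) *ᵥ x) i := by
        rw [← mulVec_mulVec]
        simp only [mulVec, dotProduct, Matrix.map_apply]
    _ = _ := Finset.sum_congr rfl fun i _ => by rw [hrow i, hφa, hu i, hJ]

/-- the self-pairing of a rational vector is rational: `⟨uᵀ J_v, u⟩ = φ(uᵀ T u)` (`J_v = (T ⊗ 1) ⊗ 1`).
[cite: MoeglinVignerasWaldspurger1987, Ch. 1 I.17] -/
theorem ratVec_vecMul_dotProduct (u : Fin N → F) :
    (((fun k => toLocalRing E v ((u k : F) : v.adicCompletion F)) ᵥ*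
        (T.map (algebraMap F (v.adicCompletion F))).map (toLocalRing E v)) ⬝ᵥ
        fun k => toLocalRing E v ((u k : F) : v.adicCompletion F)) =
      toLocalRing E v ((((u ᵥ* T) ⬝ᵥ u : F) : F) : v.adicCompletion F) := by
  set φ : F →+* UnitaryGroup.LocalRing E v := (toLocalRing E v).comp (algebraMap F (v.adicCompletion F)) with hφ
  have hφa : ∀ t : F, toLocalRing E v ((t : F) : v.adicCompletion F) = φ t := fun t => rfl
  have hJ : (T.map (algebraMap F (v.adicCompletion F))).map (toLocalRing E v) = T.map φ := by
    rw [Matrix.map_map]; rfl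
  have hu : (fun k => toLocalRing E v ((u k : F) : v.adicCompletion F)) = φ ∘ u := funext fun k => hφa (u k)
  have hvm : (⇑φ ∘ u) ᵥ* T.map φ = φ ∘ (u ᵥ* T) := funext fun i => (RingHom.map_vecMul φ T u i).symm
  rw [hJ, hu, hφa, hvm, ← RingHom.map_dotProduct]

end Reconstruct

end Literature.NumberTheory.Automorphic.UnitaryGroup

end
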